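import Summits.CriticalPhenomena.PercolationContinuityZ3.Theorems.PercNearOneGluingNoHeavyLowerTailThreePartitionOneOrTwisted
import Summits.CriticalPhenomena.PercolationContinuityZ3.Theorems.PercNearOneGluingNoHeavyLowerTailThreePartitionJunta3Check
import HarnessLib.Audit

/-!
# `NoHeavyLowerTail` (crux stmt-CriticalPhenomena-4575), master-family hierarchy P3 (gen 37): codes of the subsets of a three-element block
# and transport of the pattern sums (for the 3-JUNTA THEOREM, `…ThreePartitionJunta3`)

Support file (seat `prim-masterthm-p3`; `--supports stmt-CriticalPhenomena-4575`; memo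
`run/shared/lean/prim/prim-masterthm/FROM-prim-masterthm-p3-g37-ONE-DISJUNCTION.md` §8).  For distinct `p, q, r : ι`: `dec c` decodes a code
`c < 8` to a subset of `{p, q, r}` (bit 0 ↦ p, 1 ↦ q, 2 ↦ r), `enc` encodes the trace; `dec_enc`, `enc_dec`, `dec_xor` (XOR = symmetric difference),
`pt₃_dec`, `disjoint_dec_iff`; the pattern set `cfgsIn {p,q,r}` is the image of the 27 code pairs `L27` and `subsetsOf {p,q,r}` of the 8 codes, so
pattern sums become sums over codes (`sum_cfgsIn_eq_sum_L27`, `sum_subsetsOf_eq_sum_range`). [this work]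
-/

noncomputable section

open Finset
open scoped symmDiff

namespace Summit.CriticalPhenomena.PercolationContinuityZ3.Theorems.ThreePartition

open Junta3

variable {ι : Type*} [Fintype ι]

/-! ## Codes of the subsets of a three-element block -/

section Codes

variable (p q r : ι)

omit [Fintype ι] in
/-- Decode `c < 8` to a subset of `{p, q, r}` (bit 0 ↦ p, bit 1 ↦ q, bit 2 ↦ r). [this work] -/
def dec (c : ℕ) : Set ι := {x | (x = p ∧ c.testBit 0 = true) ∨ (x = q ∧ c.testBit 1 = true) ∨ (x = r ∧ c.testBit 2 = true)}

omit [Fintype ι] in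
open Classical in
/-- Encode the trace of a set on `{p, q, r}` as a code `< 8`. [this work] -/
def enc (m : Set ι) : ℕ := (if p ∈ m then 1 else 0) + (if q ∈ m then 2 else 0) + (if r ∈ m then 4 else 0)

omit [Fintype ι] in
/-- Membership in a decoded set. [this work] -/
theorem mem_dec {c : ℕ} {x : ι} :
    x ∈ dec p q r c ↔ (x = p ∧ c.testBit 0 = true) ∨ (x = q ∧ c.testBit 1 = true) ∨ (x = r ∧ c.testBit 2 = true) := Iff.rfl

omit [Fintype ι] in
/-- Codes are `< 8`. [this work] -/
theorem enc_lt (m : Set ι) : enc p q r m < 8 := by unfold enc; split_ifs <;> norm_num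

omit [Fintype ι] in
/-- The three low bits of a code are the three memberships. [this work] -/
theorem testBit_enc (m : Set ι) : ((enc p q r m).testBit 0 = true ↔ p ∈ m) ∧ ((enc p q r m).testBit 1 = true ↔ q ∈ m) ∧
    ((enc p q r m).testBit 2 = true ↔ r ∈ m) := by
  unfold enc
  by_cases hp : p ∈ m <;> by_cases hq : q ∈ m <;> by_cases hr : r ∈ m <;>
    simp only [hp, hq, hr, if_true, if_false, iff_true, iff_false] <;> decide

omit [Fintype ι] in
/-- Decoding the code of `m` gives back the trace `m ∩ {p,q,r}`. [this work] -/
theorem dec_enc (m : Set ι) : dec p q r (enc p q r m) = m ∩ {p, q, r} := by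
  obtain ⟨h0, h1, h2⟩ := testBit_enc p q r m
  ext x
  simp only [mem_dec, h0, h1, h2, Set.mem_inter_iff, Set.mem_insert_iff, Set.mem_singleton_iff]
  constructor
  · rintro (⟨rfl, h⟩ | ⟨rfl, h⟩ | ⟨rfl, h⟩)
    · exact ⟨h, Or.inl rfl⟩
    · exact ⟨h, Or.inr (Or.inl rfl)⟩
    · exact ⟨h, Or.inr (Or.inr rfl)⟩
  · rintro ⟨hx, rfl | rfl | rfl⟩
    · exact Or.inl ⟨rfl, hx⟩
    · exact Or.inr (Or.inl ⟨rfl, hx⟩)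
    · exact Or.inr (Or.inr ⟨rfl, hx⟩)

omit [Fintype ι] in
/-- Decoded sets lie in the block. [this work] -/
theorem dec_subset (c : ℕ) : dec p q r c ⊆ {p, q, r} := by
  intro x hx
  rcases hx with ⟨rfl, _⟩ | ⟨rfl, _⟩ | ⟨rfl, _⟩
  · exact Or.inl rfl
  · exact Or.inr (Or.inl rfl)
  · exact Or.inr (Or.inr rfl)

omit [Fintype ι] in
/-- Bitwise inclusion of codes gives inclusion of decoded sets. [this work] -/
theorem dec_mono {c c' : ℕ} (h0 : c.testBit 0 = true → c'.testBit 0 = true) (h1 : c.testBit 1 = true → c'.testBit 1 = true)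
    (h2 : c.testBit 2 = true → c'.testBit 2 = true) : dec p q r c ⊆ dec p q r c' := by
  intro x hx
  rcases hx with ⟨hx, h⟩ | ⟨hx, h⟩ | ⟨hx, h⟩
  · exact Or.inl ⟨hx, h0 h⟩
  · exact Or.inr (Or.inl ⟨hx, h1 h⟩)
  · exact Or.inr (Or.inr ⟨hx, h2 h⟩)

variable {p q r} (hd : p ≠ q ∧ p ≠ r ∧ q ≠ r)
include hd

omit [Fintype ι] in
/-- With distinct `p, q, r`: `p ∈ dec c ↔ bit 0`. [this work] -/
theorem p_mem_dec {c : ℕ} : p ∈ dec p q r c ↔ c.testBit 0 = true := by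
  rw [mem_dec]; constructor
  · rintro (⟨_, h⟩ | ⟨h, _⟩ | ⟨h, _⟩); exacts [h, absurd h hd.1, absurd h hd.2.1]
  · exact fun h => Or.inl ⟨rfl, h⟩
omit [Fintype ι] in
/-- With distinct `p, q, r`: `q ∈ dec c ↔ bit 1`. [this work] -/
theorem q_mem_dec {c : ℕ} : q ∈ dec p q r c ↔ c.testBit 1 = true := by
  rw [mem_dec]; constructor
  · rintro (⟨h, _⟩ | ⟨_, h⟩ | ⟨h, _⟩); exacts [absurd h.symm hd.1, h, absurd h hd.2.2]
  · exact fun h => Or.inr (Or.inl ⟨rfl, h⟩)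
omit [Fintype ι] in
/-- With distinct `p, q, r`: `r ∈ dec c ↔ bit 2`. [this work] -/
theorem r_mem_dec {c : ℕ} : r ∈ dec p q r c ↔ c.testBit 2 = true := by
  rw [mem_dec]; constructor
  · rintro (⟨h, _⟩ | ⟨h, _⟩ | ⟨_, h⟩); exacts [absurd h.symm hd.2.1, absurd h.symm hd.2.2, h]
  · exact fun h => Or.inr (Or.inr ⟨rfl, h⟩)

omit [Fintype ι] in
/-- Encoding a decoded code gives the code back. [this work] -/
theorem enc_dec {c : ℕ} (hc : c < 8) : enc p q r (dec p q r c) = c := by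
  obtain ⟨h0, h1, h2⟩ := testBit_enc p q r (dec p q r c)
  replace h0 := Bool.eq_iff_iff.2 (h0.trans (p_mem_dec hd))
  replace h1 := Bool.eq_iff_iff.2 (h1.trans (q_mem_dec hd))
  replace h2 := Bool.eq_iff_iff.2 (h2.trans (r_mem_dec hd))
  apply Nat.eq_of_testBit_eq
  intro i
  match i with
  | 0 => exact h0
  | 1 => exact h1
  | 2 => exact h2
  | i + 3 =>
    have h8 : (8 : ℕ) ≤ 2 ^ (i + 3) := by
      calc (8 : ℕ) = 2 ^ 3 := by norm_num
        _ ≤ 2 ^ (i + 3) := Nat.pow_le_pow_right (by norm_num) (by omega)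
    rw [Nat.testBit_lt_two_pow (lt_of_lt_of_le (enc_lt p q r _) h8), Nat.testBit_lt_two_pow (lt_of_lt_of_le hc h8)]

omit [Fintype ι] in
/-- Decoding is injective on codes `< 8`. [this work] -/
theorem dec_injOn {c₁ c₂ : ℕ} (h₁ : c₁ < 8) (h₂ : c₂ < 8) (h : dec p q r c₁ = dec p q r c₂) : c₁ = c₂ := by
  rw [← enc_dec hd h₁, h, enc_dec hd h₂]

omit [Fintype ι] in
/-- XOR of codes is symmetric difference of decoded sets. [this work] -/
theorem dec_xor (c₁ c₂ : ℕ) : dec p q r (c₁ ^^^ c₂) = dec p q r c₁ ∆ dec p q r c₂ := by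
  ext x
  rw [Set.mem_symmDiff]
  by_cases hp : x = p
  · subst hp; simp only [p_mem_dec hd, Nat.testBit_xor]
    rcases Bool.eq_false_or_eq_true (c₁.testBit 0) with h | h <;> rcases Bool.eq_false_or_eq_true (c₂.testBit 0) with h' | h' <;> simp [h, h']
  by_cases hq : x = q
  · subst hq; simp only [q_mem_dec hd, Nat.testBit_xor]
    rcases Bool.eq_false_or_eq_true (c₁.testBit 1) with h | h <;> rcases Bool.eq_false_or_eq_true (c₂.testBit 1) with h' | h' <;> simp [h, h']
  by_cases hr : x = r
  · subst hr; simp only [r_mem_dec hd, Nat.testBit_xor]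
    rcases Bool.eq_false_or_eq_true (c₁.testBit 2) with h | h <;> rcases Bool.eq_false_or_eq_true (c₂.testBit 2) with h' | h' <;> simp [h, h']
  have hn : ∀ c, x ∉ dec p q r c := fun c h => by
    rcases h with ⟨h, _⟩ | ⟨h, _⟩ | ⟨h, _⟩ <;> contradiction
  simp only [hn, not_false_eq_true, and_true, or_false]

omit [Fintype ι] in
/-- The third part of a coded pattern: `{p,q,r} \ (dec c₁ ∪ dec c₂) = dec (7 XOR (c₁ OR c₂))`. [this work] -/
theorem pt₃_dec (c₁ c₂ : ℕ) : pt₃ ({p, q, r} : Set ι) (dec p q r c₁, dec p q r c₂) = dec p q r (7 ^^^ (c₁ ||| c₂)) := by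
  unfold pt₃
  ext x
  simp only [Set.mem_sdiff, Set.mem_union, Set.mem_insert_iff, Set.mem_singleton_iff]
  have h70 : (7 : ℕ).testBit 0 = true := by decide
  have h71 : (7 : ℕ).testBit 1 = true := by decide
  have h72 : (7 : ℕ).testBit 2 = true := by decide
  by_cases hp : x = p
  · subst hp; simp only [p_mem_dec hd, Nat.testBit_xor, Nat.testBit_or, h70, true_or, true_and]
    rcases Bool.eq_false_or_eq_true (c₁.testBit 0) with h | h <;> rcases Bool.eq_false_or_eq_true (c₂.testBit 0) with h' | h' <;> simp [h, h']
  by_cases hq : x = q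
  · subst hq; simp only [q_mem_dec hd, Nat.testBit_xor, Nat.testBit_or, h71, true_or, or_true, true_and]
    rcases Bool.eq_false_or_eq_true (c₁.testBit 1) with h | h <;> rcases Bool.eq_false_or_eq_true (c₂.testBit 1) with h' | h' <;> simp [h, h']
  by_cases hr : x = r
  · subst hr; simp only [r_mem_dec hd, Nat.testBit_xor, Nat.testBit_or, h72, or_true, true_and]
    rcases Bool.eq_false_or_eq_true (c₁.testBit 2) with h | h <;> rcases Bool.eq_false_or_eq_true (c₂.testBit 2) with h' | h' <;> simp [h, h']
  have hn : ∀ c, x ∉ dec p q r c := fun c h => by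
    rcases h with ⟨h, _⟩ | ⟨h, _⟩ | ⟨h, _⟩ <;> contradiction
  simp only [hp, hq, hr, or_self, false_and, hn]

omit [Fintype ι] in
/-- Disjointness of decoded sets is bitwise disjointness of codes (`< 8`). [this work] -/
theorem disjoint_dec_iff {c₁ c₂ : ℕ} (h₁ : c₁ < 8) : Disjoint (dec p q r c₁) (dec p q r c₂) ↔ c₁ &&& c₂ = 0 := by
  rw [Set.disjoint_left]
  constructor
  · intro h
    apply Nat.eq_of_testBit_eq
    intro i
    rw [Nat.testBit_and, Nat.zero_testBit, Bool.and_eq_false_iff]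
    match i with
    | 0 =>
      cases g₁ : c₁.testBit 0
      · exact Or.inl rfl
      · cases g₂ : c₂.testBit 0
        · exact Or.inr rfl
        · exact absurd ((p_mem_dec hd).2 g₂) (h ((p_mem_dec hd).2 g₁))
    | 1 =>
      cases g₁ : c₁.testBit 1
      · exact Or.inl rfl
      · cases g₂ : c₂.testBit 1
        · exact Or.inr rfl
        · exact absurd ((q_mem_dec hd).2 g₂) (h ((q_mem_dec hd).2 g₁))
    | 2 =>
      cases g₁ : c₁.testBit 2
      · exact Or.inl rfl
      · cases g₂ : c₂.testBit 2
        · exact Or.inr rfl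
        · exact absurd ((r_mem_dec hd).2 g₂) (h ((r_mem_dec hd).2 g₁))
    | i + 3 =>
      have h8 : (8 : ℕ) ≤ 2 ^ (i + 3) := by
        calc (8 : ℕ) = 2 ^ 3 := by norm_num
          _ ≤ 2 ^ (i + 3) := Nat.pow_le_pow_right (by norm_num) (by omega)
      exact Or.inl (Nat.testBit_lt_two_pow (lt_of_lt_of_le h₁ h8))
  · intro h x hx₁ hx₂
    have hb : ∀ i, ¬ (c₁.testBit i = true ∧ c₂.testBit i = true) := fun i hh => by
      have := congrArg (fun n => Nat.testBit n i) h
      simp only [Nat.testBit_and, Nat.zero_testBit, hh.1, hh.2, Bool.and_self] at this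
      exact Bool.noConfusion this
    rcases hx₁ with ⟨rfl, g₁⟩ | ⟨rfl, g₁⟩ | ⟨rfl, g₁⟩
    · exact hb 0 ⟨g₁, (p_mem_dec hd).1 hx₂⟩
    · exact hb 1 ⟨g₁, (q_mem_dec hd).1 hx₂⟩
    · exact hb 2 ⟨g₁, (r_mem_dec hd).1 hx₂⟩

end Codes

/-! ## Transport of the pattern sums to codes -/

section Transport

variable {p q r : ι} (hd : p ≠ q ∧ p ≠ r ∧ q ≠ r)
include hd

omit [Fintype ι] hd in
/-- Membership in the explicit pattern-code list `L27`. [this work] -/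
theorem mem_L27_iff {pc : ℕ × ℕ} : pc ∈ L27 ↔ pc.1 < 8 ∧ pc.2 < 8 ∧ pc.1 &&& pc.2 = 0 := by
  constructor
  · intro h
    have hall : L27.all (fun pc => decide (pc.1 < 8 ∧ pc.2 < 8 ∧ pc.1 &&& pc.2 = 0)) = true := by decide
    rw [List.all_eq_true] at hall
    exact of_decide_eq_true (hall pc h)
  · rintro ⟨h1, h2, h3⟩
    have key : ∀ c₁ < 8, ∀ c₂ < 8, c₁ &&& c₂ ≠ 0 ∨ (c₁, c₂) ∈ L27 := by decide
    exact (key pc.1 h1 pc.2 h2).resolve_left (fun h => h h3)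

omit hd in
/-- `subsetsOf {p,q,r}` is the image of the 8 codes. [this work] -/
theorem subsetsOf_eq_image : subsetsOf ({p, q, r} : Set ι) = (Finset.range 8).image (dec p q r) := by
  ext m
  rw [mem_subsetsOf, Finset.mem_image]
  constructor
  · intro hm
    exact ⟨enc p q r m, Finset.mem_range.2 (enc_lt p q r m), by rw [dec_enc, Set.inter_eq_left.2 hm]⟩
  · rintro ⟨c, _, rfl⟩; exact dec_subset p q r c

/-- Sums over `subsetsOf {p,q,r}` as sums over codes. [this work] -/
theorem sum_subsetsOf_eq_sum_range (F : Set ι → ℤ) :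
    ∑ m ∈ subsetsOf ({p, q, r} : Set ι), F m = ∑ c ∈ Finset.range 8, F (dec p q r c) := by
  rw [subsetsOf_eq_image, Finset.sum_image]
  intro c₁ h₁ c₂ h₂ h
  exact dec_injOn hd (Finset.mem_range.1 h₁) (Finset.mem_range.1 h₂) h

/-- `cfgsIn {p,q,r}` is the image of the 27 pattern codes. [this work] -/
theorem cfgsIn_eq_image : cfgsIn ({p, q, r} : Set ι) = L27.toFinset.image (fun pc => (dec p q r pc.1, dec p q r pc.2)) := by
  ext P
  rw [mem_cfgsIn, Finset.mem_image]
  constructor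
  · rintro ⟨h1, h2, hdj⟩
    have e1 : dec p q r (enc p q r P.1) = P.1 := by rw [dec_enc, Set.inter_eq_left.2 h1]
    have e2 : dec p q r (enc p q r P.2) = P.2 := by rw [dec_enc, Set.inter_eq_left.2 h2]
    refine ⟨(enc p q r P.1, enc p q r P.2), List.mem_toFinset.2 (mem_L27_iff.2 ⟨enc_lt p q r _, enc_lt p q r _, ?_⟩), ?_⟩
    · rw [← disjoint_dec_iff hd (enc_lt p q r _), e1, e2]; exact hdj
    · dsimp only; rw [e1, e2]
  · rintro ⟨pc, hpc, rfl⟩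
    obtain ⟨h1, h2, h3⟩ := mem_L27_iff.1 (List.mem_toFinset.1 hpc)
    exact ⟨dec_subset p q r _, dec_subset p q r _, (disjoint_dec_iff hd h1).2 h3⟩

/-- Sums over `cfgsIn {p,q,r}` as sums over pattern codes. [this work] -/
theorem sum_cfgsIn_eq_sum_L27 (G : Set ι × Set ι → ℤ) :
    ∑ P ∈ cfgsIn ({p, q, r} : Set ι), G P = ∑ pc ∈ L27.toFinset, G (dec p q r pc.1, dec p q r pc.2) := by
  rw [cfgsIn_eq_image hd, Finset.sum_image]
  intro pc₁ h₁ pc₂ h₂ h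
  obtain ⟨a1, a2, _⟩ := mem_L27_iff.1 (List.mem_toFinset.1 h₁)
  obtain ⟨b1, b2, _⟩ := mem_L27_iff.1 (List.mem_toFinset.1 h₂)
  simp only [Prod.mk.injEq] at h
  exact Prod.ext (dec_injOn hd a1 b1 h.1) (dec_injOn hd a2 b2 h.2)

end Transport

end Summit.CriticalPhenomena.PercolationContinuityZ3.Theorems.ThreePartition

end
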